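import Summits.Ventures.CertifiedArithmetic.LowPrec.PatternBridge

/-!
# Pattern route of Theorem E5, part 2: realisable and placeable PRODUCT patterns — the table
# constants as a proved algorithm

HONEST FRAMING (venture CertifiedArithmetic / cell `pub-lowprec`): certified error envelopes and
provably optimal rounding/accumulation schemes for low-precision formats under stated cost models;
every table by two implementations; no hardware or vendor claims.

THEOREMS-R1 Theorem E5 (sec. 3 of `THEOREMS-R1.md`), bookkeeping half, step 2 of 2, for the
PRODUCT tables `X · Y → R` (any three binary formats). A datum of `X` has magnitude
`k · 2^j` quanta with `(k, j) ∈ sigShifts X` (`k < 2^(m_X+1)`, `j ≤ emaxCode_X - 1`,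
`k · 2^j ≤ maxScaled_X`), and conversely every listed pair is REALISED by a datum of either sign
(`Representable.lean`); hence `|a · b| = (k₁ k₂) · 2^(j₁ + j₂ + d) · quantum_R` with
`d = mulExpOffset X Y R = qexp_X + qexp_Y - qexp_R` (`abs_mul_toRat_eq`). The pattern `N = k₁ k₂`
is PLACEABLE at exponent `E = j₁ + j₂ + d` iff `2^(m_R) ≤ N · 2^E ≤ maxScaled_R` (`placedB`; ⟺
`|a · b|` lies in the normal range of `R`, `placedB_iff_of_eq`). The TABLE CONSTANT of a rounding
is the maximum over the realisable and placeable `(k₁, j₁, k₂, j₂)` of the closed-form pattern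
error of `N` from part 1 (`mulPatErrs`, `maxList0`): `envconstMulNE` (nearest), `envconstMulTZ`
(toward zero), `envconstMulDir` (round down AND round up: per pattern `max(toward-zero, away)`,
both signs being realisable — the column identity `c_RD = c_RU = max(c_towardzero, c_away)` of
`DirectedRDColumn.lean`). PROVED for every `X, Y, R`: SOUNDNESS — on the normal range of `R`
every product satisfies `|fl(a·b) - a·b| ≤ c · |a·b|` with `c` the computed constant
— and ATTAINMENT — some in-range product has error exactly `c · |a·b|` as soon as one pattern is
placeable: this file proves both as SCHEMAS over an arbitrary rounding with a pattern bridge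
(`mul_rel_le_of_bridge`, `mul_rel_attained_of_bridge`; realisation of patterns by data of either
sign `exists_data_of_mem_sigShifts`); `PatternEnvelopeMulModes.lean` instantiates them for the
four roundings, so the constants are SHARP and the third-route evaluator `code/enum/envconst.py`
(pre-registered `certs/enum/PREDICTIONS-ENVCONST*.json`) is, for products, a proved algorithm.
The definitions are kernel-reducible (natural-number placeability test), so per key the constant
is obtained by `decide` WITHOUT enumerating operand pairs (`PatternEnvelopeMulFP6FP4.lean`
recovers the FP6/FP4 product constants of `Envelopes*.lean` / `EnvelopesDirected*.lean`).
Sums `a · 2^g ± b` need the aligned-sum pattern set (not in this file).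

Placement: venture development under `Summits/Ventures/CertifiedArithmetic/`; declarations extend
the Literature structures `Format` / `MiniFloat` (CONVENTIONS §2). New work of the venture
(elementary; [folklore] tags, cf. [cite: Higham2002ASNA, §2.1]).
-/

namespace Literature.ComputerArithmetic.FloatingPoint

/-! ### Maximum of a list of rationals (default `0`) -/

/-- `max` of a list of rationals, `0` on the empty list (pattern errors are `≥ 0`). [folklore] -/
def maxList0 : List ℚ → ℚ
  | [] => 0
  | q :: l => max q (maxList0 l)

/-- Every member is below the maximum. [folklore] -/
theorem le_maxList0_of_mem {l : List ℚ} {q : ℚ} (h : q ∈ l) : q ≤ maxList0 l := by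
  induction l with
  | nil => cases h
  | cons a l ih =>
    rcases List.mem_cons.mp h with rfl | h
    · exact le_max_left _ _
    · exact le_trans (ih h) (le_max_right _ _)

/-- The maximum of a nonempty list of non-negative rationals is a member. [folklore] -/
theorem maxList0_mem_of_ne_nil {l : List ℚ} (hne : l ≠ []) (hnn : ∀ q ∈ l, 0 ≤ q) :
    maxList0 l ∈ l := by
  induction l with
  | nil => exact absurd rfl hne
  | cons a l ih =>
    by_cases hl : l = []
    · subst hl
      have ha : 0 ≤ a := hnn a (by simp)
      simp [maxList0, max_eq_left ha]
    · have hm := ih hl (fun q hq => hnn q (List.mem_cons_of_mem a hq))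
      show max a (maxList0 l) ∈ a :: l
      rcases le_total a (maxList0 l) with h | h
      · rw [max_eq_right h]; exact List.mem_cons_of_mem a hm
      · rw [max_eq_left h]; simp

namespace Format

/-! ### Realisable significand / shift pairs; placeability; the directed pattern error -/

/-- The pairs `(k, j)` with `k < 2^(m+1)`, `j ≤ emaxCode - 1`, `k · 2^j ≤ maxScaled`: exactly the
magnitudes `k · 2^j` quanta of the data of `φ` (zero included, with repetitions), cf.
`MiniFloat.representable_iff`. [cite: Higham2002ASNA, §2.1] -/
def sigShifts (φ : Format) : List (ℕ × ℕ) :=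
  (List.range (2 ^ (φ.manBits + 1))).flatMap fun k =>
    (List.range (φ.emaxCode - 1 + 1)).flatMap fun j =>
      if k * 2 ^ j ≤ φ.maxScaled then [(k, j)] else []

/-- Membership in `sigShifts`. [folklore] -/
theorem mem_sigShifts {φ : Format} {k j : ℕ} : (k, j) ∈ φ.sigShifts ↔
    k < 2 ^ (φ.manBits + 1) ∧ j ≤ φ.emaxCode - 1 ∧ k * 2 ^ j ≤ φ.maxScaled := by
  simp only [sigShifts, List.mem_flatMap, List.mem_range]
  constructor
  · rintro ⟨k', hk', j', hj', h⟩
    split_ifs at h with hc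
    · simp only [List.mem_singleton, Prod.mk.injEq] at h
      obtain ⟨rfl, rfl⟩ := h
      exact ⟨hk', by omega, hc⟩
    · simp at h
  · rintro ⟨hk, hj, hle⟩
    exact ⟨k, hk, j, by omega, by rw [if_pos hle]; simp⟩

/-- PLACEABILITY TEST: the magnitude `N · 2^E` quanta of `R` lies in the normal range
`[2^m, maxScaled]` of `R` — in natural-number arithmetic on both signs of `E` (Boolean,
kernel-reducible). [folklore] -/
def placedB (R : Format) (N : ℕ) : ℤ → Bool
  | Int.ofNat e => decide (2 ^ R.manBits ≤ N * 2 ^ e ∧ N * 2 ^ e ≤ R.maxScaled)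
  | Int.negSucc e => decide (2 ^ R.manBits * 2 ^ (e + 1) ≤ N ∧ N ≤ R.maxScaled * 2 ^ (e + 1))

/-- `placedB` over the rationals: `2^m ≤ N · 2^E ≤ maxScaled`. [folklore] -/
theorem placedB_eq_true_iff {R : Format} {N : ℕ} {E : ℤ} : R.placedB N E = true ↔
    (2 : ℚ) ^ R.manBits ≤ (N : ℚ) * 2 ^ E ∧ (N : ℚ) * 2 ^ E ≤ (R.maxScaled : ℚ) := by
  cases E with
  | ofNat e =>
    rw [placedB, decide_eq_true_iff, Int.ofNat_eq_natCast, zpow_natCast]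
    constructor
    · rintro ⟨h1, h2⟩; exact ⟨by exact_mod_cast h1, by exact_mod_cast h2⟩
    · rintro ⟨h1, h2⟩; exact ⟨by exact_mod_cast h1, by exact_mod_cast h2⟩
  | negSucc e =>
    have hp : (0 : ℚ) < 2 ^ (e + 1) := by positivity
    rw [placedB, decide_eq_true_iff, zpow_negSucc, ← div_eq_mul_inv, le_div_iff₀ hp,
      div_le_iff₀ hp]
    constructor
    · rintro ⟨h1, h2⟩; exact ⟨by exact_mod_cast h1, by exact_mod_cast h2⟩
    · rintro ⟨h1, h2⟩; exact ⟨by exact_mod_cast h1, by exact_mod_cast h2⟩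

/-- `placedB N E` says that a value of magnitude `N · 2^E · quantum_R` lies in the normal range
`[2^m · quantum_R, maxRat_R]`. [folklore] -/
theorem placedB_iff_of_eq {R : Format} {t : ℚ} {N : ℕ} {E : ℤ}
    (ht : |t| = (N : ℚ) * 2 ^ E * R.quantum) :
    R.placedB N E = true ↔ 2 ^ R.manBits * R.quantum ≤ |t| ∧ |t| ≤ R.maxRat := by
  have hq := R.quantum_pos
  rw [placedB_eq_true_iff, ht, Format.maxRat]
  constructor
  · rintro ⟨h1, h2⟩
    exact ⟨mul_le_mul_of_nonneg_right h1 hq.le, mul_le_mul_of_nonneg_right h2 hq.le⟩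
  · rintro ⟨h1, h2⟩
    exact ⟨le_of_mul_le_mul_right h1 hq, le_of_mul_le_mul_right h2 hq⟩

/-- A placeable pattern is nonzero. [folklore] -/
theorem pos_of_placedB {R : Format} {N : ℕ} {E : ℤ} (h : R.placedB N E = true) : 0 < N := by
  rcases Nat.eq_zero_or_pos N with rfl | hN
  · have h1 := (placedB_eq_true_iff.mp h).1
    simp only [Nat.cast_zero, zero_mul] at h1
    exact absurd h1 (not_le.mpr (by positivity))
  · exact hN

/-- A value in the normal range is nonzero. [folklore] -/
theorem ne_zero_of_normal {R : Format} {t : ℚ} (hlo : 2 ^ R.manBits * R.quantum ≤ |t|) :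
    t ≠ 0 := by
  have hq := R.quantum_pos
  exact abs_pos.mp (lt_of_lt_of_le (by positivity) hlo)

/-- PATTERN RELATIVE ERROR, DIRECTED COLUMN: `max(toward-zero, away)` of the pattern. [folklore] -/
def patRelErrDir (R : Format) (F N : ℕ) : ℚ := max (R.patRelErrTZ F N) (R.patRelErrAW F N)

/-- `patRelErrDir ≥ 0`. [folklore] -/
theorem patRelErrDir_nonneg {R : Format} (F N : ℕ) : 0 ≤ R.patRelErrDir F N :=
  le_max_of_le_left (patRelErrTZ_nonneg F N)

end Format

open Format

/-! ### Products: exponent offset, fuel, the placeable pattern errors, the constants -/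

/-- EXPONENT OFFSET of products: `quantum_X · quantum_Y = 2^d · quantum_R`,
`d = qexp_X + qexp_Y - qexp_R`. [folklore] -/
def mulExpOffset (X Y R : Format) : ℤ := X.qexp + Y.qexp - R.qexp

/-- `quantum_X · quantum_Y = 2^(mulExpOffset) · quantum_R`. [folklore] -/
theorem quantum_mul_quantum (X Y R : Format) :
    X.quantum * Y.quantum = 2 ^ mulExpOffset X Y R * R.quantum := by
  unfold Format.quantum mulExpOffset
  rw [← zpow_add₀ (by norm_num : (2 : ℚ) ≠ 0), ← zpow_add₀ (by norm_num : (2 : ℚ) ≠ 0)]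
  congr 1
  ring

/-- FUEL for the binade search on product significands: `k₁ k₂ < 2^(m_X + m_Y + 2)`. [folklore] -/
def mulFuel (X Y : Format) : ℕ := X.manBits + Y.manBits + 2

/-- THE REALISABLE-AND-PLACEABLE PRODUCT PATTERNS with their errors: for every
`(k₁, j₁) ∈ sigShifts X`, `(k₂, j₂) ∈ sigShifts Y` with `N = k₁ k₂` placeable at `j₁ + j₂ + d`,
the pattern error `err R (mulFuel X Y) N`. [folklore] -/
def mulPatErrs (err : Format → ℕ → ℕ → ℚ) (X Y R : Format) : List ℚ :=
  X.sigShifts.flatMap fun p => Y.sigShifts.flatMap fun q =>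
    if R.placedB (p.1 * q.1) (((p.2 + q.2 : ℕ) : ℤ) + mulExpOffset X Y R) then
      [err R (mulFuel X Y) (p.1 * q.1)] else []

/-- Membership in `mulPatErrs`. [folklore] -/
theorem mem_mulPatErrs {err : Format → ℕ → ℕ → ℚ} {X Y R : Format} {c : ℚ} :
    c ∈ mulPatErrs err X Y R ↔ ∃ k₁ j₁ k₂ j₂ : ℕ, (k₁, j₁) ∈ X.sigShifts ∧
      (k₂, j₂) ∈ Y.sigShifts ∧ R.placedB (k₁ * k₂) (((j₁ + j₂ : ℕ) : ℤ) + mulExpOffset X Y R) = true ∧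
      c = err R (mulFuel X Y) (k₁ * k₂) := by
  simp only [mulPatErrs, List.mem_flatMap]
  constructor
  · rintro ⟨⟨k₁, j₁⟩, h1, ⟨k₂, j₂⟩, h2, h⟩
    split_ifs at h with hp
    · exact ⟨k₁, j₁, k₂, j₂, h1, h2, hp, by simpa using h⟩
    · simp at h
  · rintro ⟨k₁, j₁, k₂, j₂, h1, h2, hp, rfl⟩
    exact ⟨(k₁, j₁), h1, (k₂, j₂), h2, by rw [if_pos hp]; simp⟩

/-- TABLE CONSTANT, products, round to nearest: the largest placeable pattern error. [folklore] -/
def envconstMulNE (X Y R : Format) : ℚ := maxList0 (mulPatErrs patRelErrNE X Y R)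

/-- TABLE CONSTANT, products, toward zero. [folklore] -/
def envconstMulTZ (X Y R : Format) : ℚ := maxList0 (mulPatErrs patRelErrTZ X Y R)

/-- TABLE CONSTANT, products, round down / round up (one constant for both columns). [folklore] -/
def envconstMulDir (X Y R : Format) : ℚ := maxList0 (mulPatErrs patRelErrDir X Y R)

namespace MiniFloat

variable {X Y : Format}

/-- PRODUCT OF TWO DATA IN PATTERN FORM: `|a · b| = (sig a · sig b) · 2^(bshift a + bshift b + d) ·
quantum_R`. [folklore] -/
theorem abs_mul_toRat_eq (R : Format) (a : MiniFloat X) (b : MiniFloat Y) :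
    |a.toRat * b.toRat| = ((a.sig * b.sig : ℕ) : ℚ) *
      2 ^ (((a.bshift + b.bshift : ℕ) : ℤ) + mulExpOffset X Y R) * R.quantum := by
  have h := quantum_mul_quantum X Y R
  rw [abs_mul, abs_toRat_eq_sig, abs_toRat_eq_sig, zpow_add₀ (by norm_num : (2 : ℚ) ≠ 0),
    zpow_natCast, pow_add]
  push_cast
  calc (a.sig : ℚ) * 2 ^ a.bshift * X.quantum * ((b.sig : ℚ) * 2 ^ b.bshift * Y.quantum)
      = (a.sig : ℚ) * b.sig * (2 ^ a.bshift * 2 ^ b.bshift) * (X.quantum * Y.quantum) := by ring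
    _ = (a.sig : ℚ) * b.sig * (2 ^ a.bshift * 2 ^ b.bshift * 2 ^ mulExpOffset X Y R)
          * R.quantum := by rw [h]; ring

/-- Product significands fit the fuel: `k₁ k₂ < 2^(m_R + 1 + mulFuel X Y)`. [folklore] -/
theorem mul_lt_pow_mulFuel (R : Format) {k₁ k₂ : ℕ} (h1 : k₁ < 2 ^ (X.manBits + 1))
    (h2 : k₂ < 2 ^ (Y.manBits + 1)) : k₁ * k₂ < 2 ^ (R.manBits + 1 + mulFuel X Y) :=
  calc k₁ * k₂ < 2 ^ (X.manBits + 1) * 2 ^ (Y.manBits + 1) :=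
        mul_lt_mul'' h1 h2 (Nat.zero_le _) (Nat.zero_le _)
    _ = 2 ^ mulFuel X Y := by unfold mulFuel; rw [← pow_add]; congr 1; omega
    _ ≤ 2 ^ (R.manBits + 1 + mulFuel X Y) := Nat.pow_le_pow_right (by norm_num) (by omega)

/-- The pattern of a product in the normal range of `R` is listed. [folklore] -/
theorem mem_mulPatErrs_of_normal (err : Format → ℕ → ℕ → ℚ) (R : Format) (a : MiniFloat X)
    (b : MiniFloat Y) (hlo : 2 ^ R.manBits * R.quantum ≤ |a.toRat * b.toRat|)
    (hhi : |a.toRat * b.toRat| ≤ R.maxRat) :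
    err R (mulFuel X Y) (a.sig * b.sig) ∈ mulPatErrs err X Y R := by
  rw [mem_mulPatErrs]
  exact ⟨a.sig, a.bshift, b.sig, b.bshift,
    mem_sigShifts.mpr ⟨a.sig_lt, a.bshift_le, a.sig_mul_pow_le_maxScaled⟩,
    mem_sigShifts.mpr ⟨b.sig_lt, b.bshift_le, b.sig_mul_pow_le_maxScaled⟩,
    (placedB_iff_of_eq (abs_mul_toRat_eq R a b)).mpr ⟨hlo, hhi⟩, rfl⟩

/-- SOUNDNESS SCHEMA: a rounding whose normal-range relative error at `|t| = N · 2^e · quantum_R`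
is at most `err R F N` has all its product errors below `maxList0 (mulPatErrs err X Y R) · |a·b|`.
[folklore] -/
theorem mul_rel_le_of_bridge (R : Format) (fl : ℚ → MiniFloat R) (err : Format → ℕ → ℕ → ℚ)
    (hbridge : ∀ (t : ℚ) (N : ℕ) (e : ℤ), N < 2 ^ (R.manBits + 1 + mulFuel X Y) →
      |t| = (N : ℚ) * 2 ^ e * R.quantum → 2 ^ R.manBits * R.quantum ≤ |t| → |t| ≤ R.maxRat →
        |t - (fl t).toRat| / |t| ≤ err R (mulFuel X Y) N)
    (a : MiniFloat X) (b : MiniFloat Y) (hlo : 2 ^ R.manBits * R.quantum ≤ |a.toRat * b.toRat|)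
    (hhi : |a.toRat * b.toRat| ≤ R.maxRat) :
    |(fl (a.toRat * b.toRat)).toRat - a.toRat * b.toRat|
      ≤ maxList0 (mulPatErrs err X Y R) * |a.toRat * b.toRat| := by
  have hpos : 0 < |a.toRat * b.toRat| := abs_pos.mpr (ne_zero_of_normal hlo)
  have hrel := hbridge _ _ _ (mul_lt_pow_mulFuel R a.sig_lt b.sig_lt) (abs_mul_toRat_eq R a b)
    hlo hhi
  exact abs_sub_le_mul_of_relErr_le hpos
    (le_trans hrel (le_maxList0_of_mem (mem_mulPatErrs_of_normal err R a b hlo hhi)))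

/-- `ofScaled φ false n` is positive at a positive representable magnitude. [folklore] -/
theorem toRat_ofScaled_false_pos {φ : Format} {n : ℕ} (hn : n ≤ φ.maxScaled)
    (hr : φ.Representable n) (h0 : 0 < n) : 0 < (ofScaled φ false n hn).toRat := by
  rw [toRat_ofScaled hn hr, if_neg Bool.false_ne_true]
  exact mul_pos (by exact_mod_cast h0) φ.quantum_pos

/-- `ofScaled φ neg n` is negative iff `neg`, at a positive representable magnitude. [folklore] -/
theorem toRat_ofScaled_neg_iff {φ : Format} {neg : Bool} {n : ℕ} (hn : n ≤ φ.maxScaled)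
    (hr : φ.Representable n) (h0 : 0 < n) : (ofScaled φ neg n hn).toRat < 0 ↔ neg = true := by
  rw [toRat_ofScaled hn hr]
  have hpos : (0 : ℚ) < (n : ℚ) * φ.quantum := mul_pos (by exact_mod_cast h0) φ.quantum_pos
  cases neg
  · rw [if_neg Bool.false_ne_true]
    exact ⟨fun h => absurd h (not_lt.mpr hpos.le), fun h => absurd h Bool.false_ne_true⟩
  · rw [if_pos rfl, neg_mul]
    exact ⟨fun _ => rfl, fun _ => neg_lt_zero.mpr hpos⟩

/-- REALISATION: every pair of listed nonzero patterns is the magnitude pair of two data, the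
first of either sign. [folklore] -/
theorem exists_data_of_mem_sigShifts (R : Format) {k₁ j₁ k₂ j₂ : ℕ}
    (h1 : (k₁, j₁) ∈ X.sigShifts) (h2 : (k₂, j₂) ∈ Y.sigShifts) (hk1 : 0 < k₁) (hk2 : 0 < k₂)
    (neg : Bool) :
    ∃ (a : MiniFloat X) (b : MiniFloat Y),
      |a.toRat * b.toRat| = ((k₁ * k₂ : ℕ) : ℚ) *
        2 ^ (((j₁ + j₂ : ℕ) : ℤ) + mulExpOffset X Y R) * R.quantum ∧
      (a.toRat * b.toRat < 0 ↔ neg = true) := by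
  obtain ⟨hk1', -, hle1⟩ := mem_sigShifts.mp h1
  obtain ⟨hk2', -, hle2⟩ := mem_sigShifts.mp h2
  have h := quantum_mul_quantum X Y R
  refine ⟨ofScaled X neg (k₁ * 2 ^ j₁) hle1, ofScaled Y false (k₂ * 2 ^ j₂) hle2, ?_, ?_⟩
  · rw [abs_mul, abs_toRat, abs_toRat, scaledMag_ofScaled hle1 hk1' rfl,
      scaledMag_ofScaled hle2 hk2' rfl, zpow_add₀ (by norm_num : (2 : ℚ) ≠ 0), zpow_natCast,
      pow_add]
    push_cast
    calc (k₁ : ℚ) * 2 ^ j₁ * X.quantum * ((k₂ : ℚ) * 2 ^ j₂ * Y.quantum)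
        = (k₁ : ℚ) * k₂ * (2 ^ j₁ * 2 ^ j₂) * (X.quantum * Y.quantum) := by ring
      _ = (k₁ : ℚ) * k₂ * (2 ^ j₁ * 2 ^ j₂ * 2 ^ mulExpOffset X Y R) * R.quantum := by
          rw [h]; ring
  · have ha := toRat_ofScaled_neg_iff (neg := neg) hle1 (representable_mul_pow hk1' hle1)
      (Nat.mul_pos hk1 (Nat.two_pow_pos _))
    have hb := toRat_ofScaled_false_pos hle2 (representable_mul_pow hk2' hle2)
      (Nat.mul_pos hk2 (Nat.two_pow_pos _))
    rw [← ha, mul_neg_iff]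
    constructor
    · rintro (⟨_, hb'⟩ | ⟨ha', _⟩)
      · exact absurd hb' (not_lt.mpr hb.le)
      · exact ha'
    · exact fun ha' => Or.inr ⟨ha', hb⟩

/-- ATTAINMENT SCHEMA: if the rounding's normal-range relative error at `|t| = N · 2^e · quantum_R`
EQUALS `err R F N` for `t` of the sign prescribed by `sgn N`, then `maxList0 (mulPatErrs err X Y R)`
is attained by an in-range product (once some pattern is placeable). [folklore] -/
theorem mul_rel_attained_of_bridge (R : Format) (fl : ℚ → MiniFloat R)
    (err : Format → ℕ → ℕ → ℚ) (sgn : ℕ → Bool) (hnn : ∀ N, 0 ≤ err R (mulFuel X Y) N)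
    (hbridge : ∀ (t : ℚ) (N : ℕ) (e : ℤ), t ≠ 0 → (t < 0 ↔ sgn N = true) →
      N < 2 ^ (R.manBits + 1 + mulFuel X Y) → |t| = (N : ℚ) * 2 ^ e * R.quantum →
        2 ^ R.manBits * R.quantum ≤ |t| → |t| ≤ R.maxRat →
          |t - (fl t).toRat| / |t| = err R (mulFuel X Y) N)
    (hne : mulPatErrs err X Y R ≠ []) :
    ∃ (a : MiniFloat X) (b : MiniFloat Y), 2 ^ R.manBits * R.quantum ≤ |a.toRat * b.toRat| ∧
      |a.toRat * b.toRat| ≤ R.maxRat ∧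
      |(fl (a.toRat * b.toRat)).toRat - a.toRat * b.toRat|
        = maxList0 (mulPatErrs err X Y R) * |a.toRat * b.toRat| := by
  have hmem := maxList0_mem_of_ne_nil hne (fun c hc => by
    obtain ⟨k₁, j₁, k₂, j₂, -, -, -, rfl⟩ := mem_mulPatErrs.mp hc
    exact hnn _)
  obtain ⟨k₁, j₁, k₂, j₂, h1, h2, hp, hc⟩ := mem_mulPatErrs.mp hmem
  have hN := pos_of_placedB hp
  obtain ⟨a, b, ht, hsgn⟩ := exists_data_of_mem_sigShifts R h1 h2
    (Nat.pos_of_ne_zero fun h0 => by rw [h0, zero_mul] at hN; exact lt_irrefl 0 hN)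
    (Nat.pos_of_ne_zero fun h0 => by rw [h0, mul_zero] at hN; exact lt_irrefl 0 hN)
    (sgn (k₁ * k₂))
  have hrange := (placedB_iff_of_eq ht).mp hp
  have hne0 := ne_zero_of_normal hrange.1
  have hrel := hbridge _ _ _ hne0 hsgn
    (mul_lt_pow_mulFuel R (mem_sigShifts.mp h1).1 (mem_sigShifts.mp h2).1) ht hrange.1
    hrange.2
  refine ⟨a, b, hrange.1, hrange.2, ?_⟩
  rw [hc]
  exact abs_sub_eq_mul_of_relErr_eq (abs_pos.mpr hne0) hrel

end MiniFloat

end Literature.ComputerArithmetic.FloatingPoint
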